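import Summits.BirchSwinnertonDyer.Rank1Residual.X11b.PerfectPairingAnnihilators
import Literature.NumberTheory.GaloisCohomology.PoitouTateSelmerStructures
import Literature.NumberTheory.GaloisRepresentations.LocalGlobalCohomologyFiniteProofs
import Literature.NumberTheory.GaloisRepresentations.TateDualityCounting
import HarnessLib

/-!
# Pair counting for Selmer structures, I: the summed local pairing on `⊕_{v∈T} H¹(K_v, M)`
# (cell `b2b-bsdres`, team n1011, row T-a3-F1 core rank, item CR1 of skel/T-a3-F1-CR.md — route (G2))

Honest framing of the cell: research route; theorems and four bookkeeping definitions with bodies;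
no named fact is minted.  This is the local half of the pair-counting form of Poitou–Tate duality
(`SelmerPairCounting.lean`): for a finite set `T` of finite places of a number field `K` and a
finite discrete `Γ_K`-module `M` killed by `n`,

* `finSupport T = {all infinite places} ∪ T` (`S(T)`), `locPi ρ T = loc_T : H¹(K,M) → ⊕_{v∈T} H¹(K_v,M)`,
  `piCond ρ T 𝓛 = ∏_{v∈T} 𝓛_v` with `card_piCond : #∏𝓛_v = ∏ #𝓛_v`;
* `piPairing ρ T inv = b`, `b(t,u) = ∑_{v∈T} inv_v(t_v ∪ u_v)` on `⊕_T H¹(K_v,M) × ⊕_T H¹(K_v,M^D)`,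
  **perfect on the right** when every local Tate pairing of the family `inv` is
  (`piPairing_flip_bijective`, from `inv.IsPerfect`), and **`(∏ 𝓛_v)^⊥ = ∏ 𝓛_v^*`**
  (`annRight_piCond`: X11b's `annRight` of the product condition is the product of Howard's dual
  local conditions, Def. 2.1.6);
* `⊕_{v∈T} H¹(K_v, M)` is finite and killed by `n`.

References: B. Howard, Compos. Math. 140 (2004) Def. 2.1.6; Milne, ADT I Cor. 2.3.
-/

noncomputable section

open scoped Classical NumberField
open Function NumberField IsDedekindDomain
open Literature.NumberTheory.GaloisRepresentations Literature.NumberTheory.GaloisRepresentations.DiscreteGaloisModule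
  Literature.NumberTheory.GaloisCohomology
open Summit.BirchSwinnertonDyer.Rank1Residual.X11b.FiniteDuality

universe u

namespace Summit.BirchSwinnertonDyer.Rank1Residual.GaloisImage

variable {K : Type u} [Field K] [NumberField K] {n : ℕ}
variable {M : Type u} [AddCommGroup M] [TopologicalSpace M] [DiscreteTopology M] [Finite M]

/-! ### Bookkeeping: `S(T)`, `loc_T`, `∏_{v∈T} 𝓛_v`, the summed local pairing -/

/-- `S(T) = {all infinite places} ∪ T` as a finite set of places. [folklore] -/
def finSupport (T : Finset (HeightOneSpectrum (𝓞 K))) : Finset (Place K) :=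
  Finset.univ.map ⟨Sum.inl, Sum.inl_injective⟩ ∪ T.map ⟨Sum.inr, Sum.inr_injective⟩

omit [NumberField K] in
/-- Every infinite place lies in `S(T)`. [folklore] -/
@[simp] theorem inl_mem_finSupport [NumberField K] (T : Finset (HeightOneSpectrum (𝓞 K)))
    (w : InfinitePlace K) : (Sum.inl w : Place K) ∈ finSupport T := by
  simp [finSupport]

/-- A finite place lies in `S(T)` iff it lies in `T`. [folklore] -/
@[simp] theorem inr_mem_finSupport_iff (T : Finset (HeightOneSpectrum (𝓞 K)))
    (v : HeightOneSpectrum (𝓞 K)) : (Sum.inr v : Place K) ∈ finSupport T ↔ v ∈ T := by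
  simp [finSupport]

/-- A sum over `S(T)` splits into the infinite places and `T`. [folklore] -/
theorem sum_finSupport {β : Type*} [AddCommMonoid β] (T : Finset (HeightOneSpectrum (𝓞 K)))
    (f : Place K → β) :
    ∑ v ∈ finSupport T, f v = ∑ w : InfinitePlace K, f (Sum.inl w) + ∑ v ∈ T, f (Sum.inr v) := by
  rw [finSupport, Finset.sum_union, Finset.sum_map, Finset.sum_map]
  · rfl
  · rw [Finset.disjoint_left]
    rintro x hx hx'
    simp only [Finset.mem_map, Finset.mem_univ, Function.Embedding.coeFn_mk, true_and] at hx hx'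
    obtain ⟨w, rfl⟩ := hx
    obtain ⟨v, _, hv⟩ := hx'
    exact Sum.inr_ne_inl hv

variable (ρ : DiscreteGaloisModule K M) (T : Finset (HeightOneSpectrum (𝓞 K)))

/-- `loc_T : H¹(K, M) → ⊕_{v ∈ T} H¹(K_v, M)`. [folklore] -/
def locPi : galoisCohomology ρ 1 →+ Π v : T, galoisCohomology (ρ.toLocal (Sum.inr v.1)) 1 :=
  AddMonoidHom.pi fun v => galoisCohomology.localization ρ (Sum.inr v.1) 1

omit [NumberField K] [Finite M] in
/-- Components of `loc_T`. [folklore] -/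
@[simp] theorem locPi_apply [NumberField K] (x : galoisCohomology ρ 1) (v : T) :
    locPi ρ T x v = galoisCohomology.localization ρ (Sum.inr v.1) 1 x := rfl

/-- `∏_{v ∈ T} 𝓛_v ≤ ⊕_{v ∈ T} H¹(K_v, M)`. [folklore] -/
def piCond (𝓛 : SelmerStructure ρ) :
    AddSubgroup (Π v : T, galoisCohomology (ρ.toLocal (Sum.inr v.1)) 1) :=
  AddSubgroup.pi Set.univ fun v => 𝓛 (Sum.inr v.1)

omit [NumberField K] [Finite M] in
/-- Membership in `∏_{v ∈ T} 𝓛_v`. [folklore] -/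
@[simp] theorem mem_piCond_iff [NumberField K] (𝓛 : SelmerStructure ρ)
    (t : Π v : T, galoisCohomology (ρ.toLocal (Sum.inr v.1)) 1) :
    t ∈ piCond ρ T 𝓛 ↔ ∀ v : T, t v ∈ 𝓛 (Sum.inr v.1) := by
  simp [piCond, AddSubgroup.mem_pi]

omit [NumberField K] [Finite M] in
/-- `∏ 𝓕_v ≤ ∏ 𝓖_v` for `𝓕 ≤ 𝓖`. [folklore] -/
theorem piCond_mono [NumberField K] {𝓕 𝓖 : SelmerStructure ρ} (h : 𝓕 ≤ 𝓖) :
    piCond ρ T 𝓕 ≤ piCond ρ T 𝓖 := fun t ht =>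
  (mem_piCond_iff ρ T 𝓖 t).mpr fun v => h _ ((mem_piCond_iff ρ T 𝓕 t).mp ht v)

omit [NumberField K] [Finite M] in
/-- `#∏_{v∈T} 𝓛_v = ∏_{v∈T} #𝓛_v`. [folklore] -/
theorem card_piCond [NumberField K] (𝓛 : SelmerStructure ρ) :
    Nat.card (piCond ρ T 𝓛) = ∏ v ∈ T, Nat.card (𝓛 (Sum.inr v)) := by
  let e : piCond ρ T 𝓛 ≃ Π v : T, 𝓛 (Sum.inr v.1) :=
    { toFun := fun t v => ⟨t.1 v, (mem_piCond_iff ρ T 𝓛 t.1).mp t.2 v⟩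
      invFun := fun s => ⟨fun v => (s v : _), (mem_piCond_iff ρ T 𝓛 _).mpr fun v => (s v).2⟩
      left_inv := fun t => rfl
      right_inv := fun s => rfl }
  rw [Nat.card_congr e, Nat.card_pi]
  exact Finset.prod_coe_sort T fun v => Nat.card (𝓛 (Sum.inr v))

variable (inv : LocalInvariants K n)

/-- The summed local pairing `b(t, u) = ∑_{v ∈ T} inv_v(t_v ∪ u_v)` on
`⊕_{v∈T} H¹(K_v, M) × ⊕_{v∈T} H¹(K_v, M^D)`. [folklore] -/
def piPairing : (Π v : T, galoisCohomology (ρ.toLocal (Sum.inr v.1)) 1) →+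
    (Π v : T, galoisCohomology ((ρ.tateDual n).toLocal (Sum.inr v.1)) 1) →+ ZMod n :=
  ∑ v : T, ((localTatePairingZMod ρ n (Sum.inr v.1) (inv (Sum.inr v.1))).comp
    (Pi.evalAddMonoidHom (fun w : T => galoisCohomology (ρ.toLocal (Sum.inr w.1)) 1) v)).compl₂
      (Pi.evalAddMonoidHom (fun w : T => galoisCohomology ((ρ.tateDual n).toLocal (Sum.inr w.1)) 1) v)

/-- `b(t, u) = ∑_v inv_v(t_v ∪ u_v)`. [folklore] -/
theorem piPairing_apply (t : Π v : T, galoisCohomology (ρ.toLocal (Sum.inr v.1)) 1)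
    (u : Π v : T, galoisCohomology ((ρ.tateDual n).toLocal (Sum.inr v.1)) 1) :
    piPairing ρ T inv t u =
      ∑ v : T, localTatePairingZMod ρ n (Sum.inr v.1) (inv (Sum.inr v.1)) (t v) (u v) := by
  simp [piPairing]

/-- `b(δ_v a, u) = inv_v(a ∪ u_v)`. [folklore] -/
theorem piPairing_single (v : T) (a : galoisCohomology (ρ.toLocal (Sum.inr v.1)) 1)
    (u : Π v : T, galoisCohomology ((ρ.tateDual n).toLocal (Sum.inr v.1)) 1) :
    piPairing ρ T inv (Pi.single v a) u =
      localTatePairingZMod ρ n (Sum.inr v.1) (inv (Sum.inr v.1)) a (u v) := by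
  rw [piPairing_apply, Finset.sum_eq_single v]
  · rw [Pi.single_eq_same]
  · intro w _ hw
    rw [Pi.single_eq_of_ne hw, map_zero, AddMonoidHom.zero_apply]
  · intro h; exact absurd (Finset.mem_univ v) h

/-- `b(t, δ_v c) = inv_v(t_v ∪ c)`. [folklore] -/
theorem piPairing_single_right (v : T) (t : Π v : T, galoisCohomology (ρ.toLocal (Sum.inr v.1)) 1)
    (c : galoisCohomology ((ρ.tateDual n).toLocal (Sum.inr v.1)) 1) :
    piPairing ρ T inv t (Pi.single v c) =
      localTatePairingZMod ρ n (Sum.inr v.1) (inv (Sum.inr v.1)) (t v) c := by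
  rw [piPairing_apply, Finset.sum_eq_single v]
  · rw [Pi.single_eq_same]
  · intro w _ hw
    rw [Pi.single_eq_of_ne hw, map_zero]
  · intro h; exact absurd (Finset.mem_univ v) h

/-- **The summed local pairing is perfect on the right** (right adjoint bijective) when every local
pairing is (`inv.IsPerfect`). [folklore] -/
theorem piPairing_flip_bijective (hperf : inv.IsPerfect) (hM : ∀ m : M, n • m = 0) :
    Bijective (piPairing ρ T inv).flip := by
  have hloc : ∀ v : T, Bijective
      (localTatePairingZMod ρ n (Sum.inr v.1) (inv (Sum.inr v.1))).flip :=
    fun v => ((hperf v.1).2 ρ hM).2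
  constructor
  · intro u u' h
    funext v
    apply (hloc v).1
    ext a
    have := congrArg (fun φ => φ (Pi.single v a)) h
    simpa only [AddMonoidHom.flip_apply, piPairing_single] using this
  · intro φ
    choose u hu using fun v : T => (hloc v).2 (φ.comp
      (AddMonoidHom.single (fun w : T => galoisCohomology (ρ.toLocal (Sum.inr w.1)) 1) v))
    refine ⟨u, AddMonoidHom.ext fun t => ?_⟩
    rw [AddMonoidHom.flip_apply, piPairing_apply]
    calc ∑ v : T, localTatePairingZMod ρ n (Sum.inr v.1) (inv (Sum.inr v.1)) (t v) (u v)
        = ∑ v : T, φ (Pi.single v (t v)) := Finset.sum_congr rfl fun v _ => by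
          have := congrArg (fun ψ => ψ (t v)) (hu v)
          simpa only [AddMonoidHom.flip_apply, AddMonoidHom.coe_comp, comp_apply,
            AddMonoidHom.single_apply] using this
      _ = φ (∑ v : T, Pi.single v (t v)) := by rw [map_sum]
      _ = φ t := by rw [Finset.univ_sum_single]

/-- **`(∏ 𝓛_v)^⊥ = ∏ 𝓛_v^*`**: the right annihilator of `∏_{v∈T} 𝓛_v` under the summed pairing is
the product of the dual local conditions (Howard Def. 2.1.6, place by place). [folklore] -/
theorem annRight_piCond (𝓛 : SelmerStructure ρ) :
    annRight (piPairing ρ T inv) (piCond ρ T 𝓛) = piCond (ρ.tateDual n) T (inv.dualSelmerStructure ρ 𝓛) := by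
  ext u
  rw [mem_annRight_iff, mem_piCond_iff]
  constructor
  · intro h v
    rw [LocalInvariants.dualSelmerStructure_apply, LocalInvariants.mem_dualLocalCondition_iff]
    intro a ha
    rw [← piPairing_single ρ T inv v a u]
    refine h _ ((mem_piCond_iff ρ T 𝓛 _).mpr fun w => ?_)
    by_cases hw : w = v
    · subst hw; rw [Pi.single_eq_same]; exact ha
    · rw [Pi.single_eq_of_ne hw]; exact zero_mem _
  · intro h t ht
    rw [piPairing_apply]
    refine Finset.sum_eq_zero fun v _ => ?_
    have hv := h v
    rw [LocalInvariants.dualSelmerStructure_apply, LocalInvariants.mem_dualLocalCondition_iff] at hv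
    exact hv _ ((mem_piCond_iff ρ T 𝓛 t).mp ht v)


omit [Finite M] in
/-- Every local class is killed by `n` (for `M` killed by `n`). [folklore] -/
theorem nsmul_pi_galoisCohomology_eq_zero (hM : ∀ m : M, n • m = 0)
    (t : Π v : T, galoisCohomology (ρ.toLocal (Sum.inr v.1)) 1) : n • t = 0 := by
  funext v
  exact nsmul_continuousCohomology_one_eq_zero _ n hM (t v)

/-- `⊕_{v∈T} H¹(K_v, M)` is finite. [folklore] -/
instance finite_pi_galoisCohomology_toLocal :
    Finite (Π v : T, galoisCohomology (ρ.toLocal (Sum.inr v.1)) 1) := by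
  haveI : ∀ v : T, Finite (galoisCohomology (ρ.toLocal (Sum.inr v.1)) 1) := fun v => by
    haveI : CharZero (v.1.adicCompletion K) := charZero_adicCompletion v.1
    change Finite (galoisCohomology (GaloisRep.restrictField (v.1.adicCompletion K) ρ) 1)
    exact finite_galoisCohomology_one_of_isNonarchimedeanLocalField _
  infer_instance

end Summit.BirchSwinnertonDyer.Rank1Residual.GaloisImage

end
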